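import Mathlib
import Summits.AtomisticToContinuum.HydrodynamicLimit.Theorems.ImplosionDichotomyDenseExcursionCavityCentreEuler

/-!
# The profile and a regular source in the signed radius: smooth even data at the centre (for theorem T3, existence)
# (crux `DenseExcursion`, line `sonic-cavity-renewal`, stub `stub_cavityResolventCk`)

Helper file (`--supports stmt-AtomisticToContinuum-12586`, line lead a2, stub-worker E for `stub_cavityResolventCk`,
theorem T3 `centre_regular_branch`, EXISTENCE half). The resolvent equation at the centre is rewritten in the SIGNED
RADIUS `R = ±eˣ`; this file produces the smooth even coefficient data on all of `ℝ` (no Whitney theorem is used: the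
smooth fields on `ℝ³` of `IsMonatomicProfile` / `IsRegularPair` are restricted to the line `R ↦ R·e₀` and divided by
`R` with Hadamard's lemma):

* `hadamard_quotient_real` — real-valued Hadamard lemma;
* `profile_radial_data` (registered helper): from `IsMonatomicProfile r W S` there are `C^∞` EVEN `𝓌 σ : ℝ → ℝ` with
  `𝓌 R = W(log|R|)`, `σ R = |R|·S(log|R|)` for `R ≠ 0` and `σ > 0` everywhere (`σ 0 = G 0 > 0`);
* `source_radial_data`: from `IsRegularPair f g` there are `C^∞` EVEN `𝒻 𝓰 : ℝ → ℂ` with `𝒻 R = f(log|R|)`,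
  `𝓰 R = |R|·g(log|R|)` for `R ≠ 0`;
* `exists_even_nonvanishing_eq_near_zero` — a smooth even `D` with `D 0 < 0` agrees near `0` with a smooth even
  NOWHERE-VANISHING `D̃` (convex combination with `D 0` through an even smooth cut-off built from `Real.smoothTransition`
  of `R²`); used to globalise the coefficients `…/det`, `det = (𝓌−1)²R² − σ²`, `det(0) = −σ(0)² < 0`.

Sources: folklore.
-/

noncomputable section

open Set Filter MeasureTheory intervalIntegral
open scoped Topology ContDiff

namespace Summit.AtomisticToContinuum.HydrodynamicLimit.Theorems.SonicCavityRenewal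

open Summit.AtomisticToContinuum.HydrodynamicLimit.Theorems.R2OneModeTwoConditions
open Summit.AtomisticToContinuum.HydrodynamicLimit.Theorems.KidderKnobMelnikov (smul_unitVec_apply_zero)
open Literature.MathematicalPhysics.KineticTheory (V3)

/-! ## Real Hadamard lemma -/

/-- HADAMARD'S LEMMA, real-valued: `φ` smooth with `φ 0 = 0` is `t·ψ t` with `ψ` smooth. [folklore] -/
theorem hadamard_quotient_real {φ : ℝ → ℝ} (hφ : ContDiff ℝ ∞ φ) (h0 : φ 0 = 0) :
    ∃ ψ : ℝ → ℝ, ContDiff ℝ ∞ ψ ∧ ∀ t, φ t = t * ψ t := by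
  have hφ' : ContDiff ℝ ∞ (deriv φ) := (contDiff_infty_iff_deriv.1 hφ).2
  refine ⟨fun t => ∫ s in (0 : ℝ)..1, deriv φ (t * s), ?_, fun t => ?_⟩
  · have hF : ContDiff ℝ (⊤ : ℕ∞) (Function.uncurry fun (t s : ℝ) => deriv φ (t * s)) :=
      hφ'.comp (contDiff_fst.mul contDiff_snd)
    exact Literature.Analysis.Calculus.contDiff_intervalIntegral hF 0 1
  · rcases eq_or_ne t 0 with rfl | ht
    · simp [h0]
    · have hsub : (∫ s in (0 : ℝ)..1, deriv φ (t * s)) = t⁻¹ • ∫ s in (0 : ℝ)..t, deriv φ s := by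
        have h := intervalIntegral.integral_comp_mul_left (fun s => deriv φ s) (a := 0) (b := 1) ht
        simpa using h
      have hFTC : (∫ s in (0 : ℝ)..t, deriv φ s) = φ t - φ 0 :=
        integral_deriv_eq_sub (fun s _ => hφ.differentiable (by simp) s) (hφ'.continuous.intervalIntegrable _ _)
      show φ t = t * ∫ s in (0 : ℝ)..1, deriv φ (t * s)
      rw [hsub, hFTC, h0, sub_zero, smul_eq_mul]
      field_simp

/-! ## The line `R ↦ R·e₀` -/

/-- The norm of `R·e₀` is `|R|`. [folklore] -/
theorem norm_smul_single (R : ℝ) : ‖R • (EuclideanSpace.single 0 1 : V3)‖ = |R| := by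
  rw [norm_smul, PiLp.norm_single, norm_one, mul_one, Real.norm_eq_abs]

/-- `R·e₀ ≠ 0` for `R ≠ 0`. [folklore] -/
theorem smul_single_ne_zero {R : ℝ} (hR : R ≠ 0) : R • (EuclideanSpace.single 0 1 : V3) ≠ 0 := by
  intro h
  have := congrArg (fun y : V3 => ‖y‖) h
  simp only [norm_smul_single, norm_zero, abs_eq_zero] at this
  exact hR this

/-- CONTINUITY AT THE ORIGIN KILLS ODD FUNCTIONS: if `φ` is continuous and `φ (−t) = −φ t` for `t ≠ 0` then `φ 0 = 0`.
[folklore] -/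
theorem eq_zero_of_odd_of_continuous {E : Type*} [NormedAddCommGroup E] [NormedSpace ℝ E] {φ : ℝ → E}
    (hφ : Continuous φ) (hodd : ∀ t, t ≠ 0 → φ (-t) = -φ t) : φ 0 = 0 := by
  have hsum : Continuous fun t => φ t + φ (-t) := hφ.add (hφ.comp continuous_neg)
  have hzero : ∀ t, t ≠ 0 → φ t + φ (-t) = 0 := fun t ht => by rw [hodd t ht, add_neg_cancel]
  have hlim : Tendsto (fun t => φ t + φ (-t)) (𝓝[≠] (0 : ℝ)) (𝓝 (φ 0 + φ (-0))) :=
    (hsum.tendsto 0).mono_left nhdsWithin_le_nhds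
  have hlim' : Tendsto (fun t : ℝ => φ t + φ (-t)) (𝓝[≠] (0 : ℝ)) (𝓝 0) :=
    tendsto_const_nhds.congr' (eventually_nhdsWithin_of_forall fun t ht => (hzero t ht).symm)
  have h := tendsto_nhds_unique hlim hlim'
  rw [neg_zero, ← two_smul ℝ (φ 0)] at h
  exact (smul_eq_zero.1 h).resolve_left two_ne_zero

/-! ## The profile in the signed radius -/

/-- **Registered helper `profile_radial_data`: THE PROFILE IN THE SIGNED RADIUS.** From `IsMonatomicProfile r W S`
(smooth radial fields `F y = W(log‖y‖)·y`, `G y = ‖y‖·S(log‖y‖)`, `G 0 > 0`) there are `C^∞` EVEN functions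
`𝓌 σ : ℝ → ℝ` with `𝓌 R = W(log|R|)`, `σ R = |R|·S(log|R|)` for `R ≠ 0`, and `σ > 0` on `ℝ` (restrict the fields to
the line `R·e₀`; `𝓌 = (F(Re₀))₀/R` by Hadamard, the continuous odd function `(F(Re₀))₀` vanishing at `0`). [folklore] -/
theorem profile_radial_data : ∀ (r : ℝ) (W S : ℝ → ℝ), IsMonatomicProfile r W S → ∃ 𝓌 σ : ℝ → ℝ, ContDiff ℝ ∞ 𝓌 ∧ ContDiff ℝ ∞ σ ∧ (∀ R, 𝓌 (-R) = 𝓌 R ∧ σ (-R) = σ R) ∧ (∀ R, R ≠ 0 → 𝓌 R = W (Real.log |R|) ∧ σ R = |R| * S (Real.log |R|)) ∧ ∀ R, 0 < σ R := by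
  intro r W S hP
  obtain ⟨-, -, -, -, hSpos, -, ⟨F, G, hF, hG, hG0, hFG⟩, -, -⟩ := hP
  set e₀ : V3 := EuclideanSpace.single 0 1 with he₀
  have hline : ContDiff ℝ ∞ fun R : ℝ => R • e₀ := contDiff_id.smul contDiff_const
  -- the odd smooth function `φ R = (F (R e₀))₀ = R·W(log|R|)`
  set φ : ℝ → ℝ := fun R => (F (R • e₀)) 0 with hφ
  have hφs : ContDiff ℝ ∞ φ := (contDiff_piLp 2).1 (hF.comp hline) 0
  have hφval : ∀ R, R ≠ 0 → φ R = R * W (Real.log |R|) := by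
    intro R hR
    have h := (hFG (R • e₀) (smul_single_ne_zero hR)).1
    rw [norm_smul_single] at h
    simp only [hφ]
    rw [← h, smul_smul, smul_unitVec_apply_zero]
    ring
  have hφ0 : φ 0 = 0 := by
    refine eq_zero_of_odd_of_continuous hφs.continuous fun t ht => ?_
    rw [hφval t ht, hφval (-t) (neg_ne_zero.2 ht), abs_neg]
    ring
  obtain ⟨𝓌, h𝓌, h𝓌eq⟩ := hadamard_quotient_real hφs hφ0
  -- `σ R = G (R e₀)`
  set σ : ℝ → ℝ := fun R => G (R • e₀) with hσ
  have hσs : ContDiff ℝ ∞ σ := hG.comp hline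
  have hσval : ∀ R, R ≠ 0 → σ R = |R| * S (Real.log |R|) := by
    intro R hR
    have h := (hFG (R • e₀) (smul_single_ne_zero hR)).2
    rw [norm_smul_single] at h
    exact h.symm
  have h𝓌val : ∀ R, R ≠ 0 → 𝓌 R = W (Real.log |R|) := by
    intro R hR
    have h1 := h𝓌eq R
    rw [hφval R hR] at h1
    exact (mul_left_cancel₀ hR h1).symm
  refine ⟨𝓌, σ, h𝓌, hσs, fun R => ⟨?_, ?_⟩, fun R hR => ⟨h𝓌val R hR, hσval R hR⟩, fun R => ?_⟩
  · rcases eq_or_ne R 0 with rfl | hR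
    · simp
    · rw [h𝓌val R hR, h𝓌val (-R) (neg_ne_zero.2 hR), abs_neg]
  · rcases eq_or_ne R 0 with rfl | hR
    · simp
    · rw [hσval R hR, hσval (-R) (neg_ne_zero.2 hR), abs_neg]
  · rcases eq_or_ne R 0 with rfl | hR
    · simpa [hσ] using hG0
    · rw [hσval R hR]; exact mul_pos (abs_pos.2 hR) (hSpos _)

/-- A REGULAR SOURCE IN THE SIGNED RADIUS: from `IsRegularPair f g` there are `C^∞` EVEN `𝒻 𝓰 : ℝ → ℂ` with
`𝒻 R = f(log|R|)` and `𝓰 R = |R|·g(log|R|)` for `R ≠ 0` (same construction with the four fields of the pair).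
[folklore] -/
theorem source_radial_data {f g : ℝ → ℂ} (h : IsRegularPair f g) :
    ∃ 𝒻 𝓰 : ℝ → ℂ, ContDiff ℝ ∞ 𝒻 ∧ ContDiff ℝ ∞ 𝓰 ∧ (∀ R, 𝒻 (-R) = 𝒻 R ∧ 𝓰 (-R) = 𝓰 R) ∧
      ∀ R, R ≠ 0 → 𝒻 R = f (Real.log |R|) ∧ 𝓰 R = |R| * g (Real.log |R|) := by
  obtain ⟨-, -, F₁, F₂, G₁, G₂, hF₁, hF₂, hG₁, hG₂, hFG⟩ := h
  set e₀ : V3 := EuclideanSpace.single 0 1 with he₀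
  have hline : ContDiff ℝ ∞ fun R : ℝ => R • e₀ := contDiff_id.smul contDiff_const
  set φ : ℝ → ℂ := fun R => (((F₁ (R • e₀)) 0 : ℝ) : ℂ) + (((F₂ (R • e₀)) 0 : ℝ) : ℂ) * Complex.I with hφ
  have hφs : ContDiff ℝ ∞ φ :=
    (Complex.ofRealCLM.contDiff.comp ((contDiff_piLp 2).1 (hF₁.comp hline) 0)).add
      ((Complex.ofRealCLM.contDiff.comp ((contDiff_piLp 2).1 (hF₂.comp hline) 0)).mul contDiff_const)
  have hφval : ∀ R, R ≠ 0 → φ R = R * f (Real.log |R|) := by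
    intro R hR
    obtain ⟨h1, h2, -, -⟩ := hFG (R • e₀) (smul_single_ne_zero hR)
    rw [norm_smul_single] at h1 h2
    have e1 : (F₁ (R • e₀)) 0 = (f (Real.log |R|)).re * R := by
      rw [← h1, smul_smul, smul_unitVec_apply_zero]
    have e2 : (F₂ (R • e₀)) 0 = (f (Real.log |R|)).im * R := by
      rw [← h2, smul_smul, smul_unitVec_apply_zero]
    simp only [hφ, e1, e2]
    conv_rhs => rw [← Complex.re_add_im (f (Real.log |R|))]
    push_cast
    ring
  have hφ0 : φ 0 = 0 := by
    refine eq_zero_of_odd_of_continuous hφs.continuous fun t ht => ?_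
    rw [hφval t ht, hφval (-t) (neg_ne_zero.2 ht), abs_neg]
    push_cast; ring
  obtain ⟨𝒻, h𝒻, h𝒻eq, -⟩ := hadamard_quotient hφs hφ0
  set 𝓰 : ℝ → ℂ := fun R => ((G₁ (R • e₀) : ℝ) : ℂ) + ((G₂ (R • e₀) : ℝ) : ℂ) * Complex.I with h𝓰
  have h𝓰s : ContDiff ℝ ∞ 𝓰 :=
    (Complex.ofRealCLM.contDiff.comp (hG₁.comp hline)).add
      ((Complex.ofRealCLM.contDiff.comp (hG₂.comp hline)).mul contDiff_const)
  have h𝓰val : ∀ R, R ≠ 0 → 𝓰 R = |R| * g (Real.log |R|) := by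
    intro R hR
    obtain ⟨-, -, h3, h4⟩ := hFG (R • e₀) (smul_single_ne_zero hR)
    rw [norm_smul_single] at h3 h4
    simp only [h𝓰, ← h3, ← h4]
    conv_rhs => rw [← Complex.re_add_im (g (Real.log |R|))]
    push_cast
    ring
  have h𝒻val : ∀ R, R ≠ 0 → 𝒻 R = f (Real.log |R|) := by
    intro R hR
    have h1 := h𝒻eq R
    rw [hφval R hR] at h1
    exact (mul_left_cancel₀ (Complex.ofReal_ne_zero.2 hR) h1).symm
  refine ⟨𝒻, 𝓰, h𝒻, h𝓰s, fun R => ⟨?_, ?_⟩, fun R hR => ⟨h𝒻val R hR, h𝓰val R hR⟩⟩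
  · rcases eq_or_ne R 0 with rfl | hR
    · simp
    · rw [h𝒻val R hR, h𝒻val (-R) (neg_ne_zero.2 hR), abs_neg]
  · rcases eq_or_ne R 0 with rfl | hR
    · simp
    · rw [h𝓰val R hR, h𝓰val (-R) (neg_ne_zero.2 hR), abs_neg]

/-! ## Globalising the determinant -/

/-- A SMOOTH EVEN FUNCTION NEGATIVE AT `0` AGREES NEAR `0` WITH A SMOOTH EVEN NOWHERE-VANISHING ONE: with an even smooth
cut-off `χ` (`= 1` near `0`, `= 0` off a small ball, built from `Real.smoothTransition` of `R²`),
`D̃ = χ·D + (1 − χ)·D(0)` is a convex combination of negative numbers. [folklore] -/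
theorem exists_even_nonvanishing_eq_near_zero {D : ℝ → ℝ} (hD : ContDiff ℝ ∞ D) (heven : ∀ R, D (-R) = D R)
    (h0 : D 0 < 0) :
    ∃ Dt : ℝ → ℝ, ContDiff ℝ ∞ Dt ∧ (∀ R, Dt (-R) = Dt R) ∧ (∀ R, Dt R ≠ 0) ∧
      ∃ ρ : ℝ, 0 < ρ ∧ ∀ R, |R| < ρ → Dt R = D R := by
  -- a ball on which `D ≤ D 0 / 2 < 0`
  have hcont : ContinuousAt D 0 := hD.continuous.continuousAt
  have hev : ∀ᶠ R in 𝓝 (0 : ℝ), D R < D 0 / 2 := hcont.eventually (gt_mem_nhds (by linarith))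
  obtain ⟨ρ₀, hρ₀, hball⟩ := Metric.eventually_nhds_iff.1 hev
  have hneg : ∀ R, |R| < ρ₀ → D R < D 0 / 2 := fun R hR => hball (by simpa [Real.dist_eq] using hR)
  -- the even cut-off `χ R = smoothTransition ((ρ₀²/4 - R²) · 16/(3ρ₀²) + 1)`: `= 1` for `R² ≤ ρ₀²/16`... we use the affine
  -- map sending `R² = ρ₀²/16` to `1` and `R² = ρ₀²/4` to `0`.
  set L : ℝ → ℝ := fun R => (ρ₀ ^ 2 / 4 - R ^ 2) * (16 / (3 * ρ₀ ^ 2)) with hL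
  set χ : ℝ → ℝ := fun R => Real.smoothTransition (L R) with hχ
  have hχs : ContDiff ℝ ∞ χ := Real.smoothTransition.contDiff.comp (by rw [hL]; fun_prop)
  have hχe : ∀ R, χ (-R) = χ R := fun R => by simp [hχ, hL]
  have hχ1 : ∀ R, |R| < ρ₀ / 4 → χ R = 1 := by
    intro R hR
    apply Real.smoothTransition.one_of_one_le
    have hR2 : R ^ 2 < (ρ₀ / 4) ^ 2 := by
      have := abs_nonneg R
      calc R ^ 2 = |R| ^ 2 := (sq_abs R).symm
        _ < (ρ₀ / 4) ^ 2 := by gcongr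
    show 1 ≤ (ρ₀ ^ 2 / 4 - R ^ 2) * (16 / (3 * ρ₀ ^ 2))
    have hρ2 : 0 < 3 * ρ₀ ^ 2 := by positivity
    rw [← sub_nonneg]
    have e : (ρ₀ ^ 2 / 4 - R ^ 2) * (16 / (3 * ρ₀ ^ 2)) - 1 = (ρ₀ ^ 2 - 16 * R ^ 2) / (3 * ρ₀ ^ 2) := by
      field_simp; ring
    rw [e]
    exact div_nonneg (by nlinarith) hρ2.le
  have hχ0 : ∀ R, ρ₀ / 2 ≤ |R| → χ R = 0 := by
    intro R hR
    apply Real.smoothTransition.zero_of_nonpos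
    have hR2 : (ρ₀ / 2) ^ 2 ≤ R ^ 2 := by
      calc (ρ₀ / 2) ^ 2 ≤ |R| ^ 2 := by gcongr
        _ = R ^ 2 := sq_abs R
    show (ρ₀ ^ 2 / 4 - R ^ 2) * (16 / (3 * ρ₀ ^ 2)) ≤ 0
    exact mul_nonpos_of_nonpos_of_nonneg (by nlinarith) (by positivity)
  have hχ01 : ∀ R, 0 ≤ χ R ∧ χ R ≤ 1 := fun R =>
    ⟨Real.smoothTransition.nonneg _, Real.smoothTransition.le_one _⟩
  refine ⟨fun R => χ R * D R + (1 - χ R) * D 0, (hχs.mul hD).add ((contDiff_const.sub hχs).mul contDiff_const),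
    fun R => by simp only [hχe, heven], fun R => ?_, ρ₀ / 4, by positivity, fun R hR => ?_⟩
  · -- nowhere zero: a convex combination of numbers `≤ D 0 / 2 < 0` on `|R| < ρ₀`, and `= D 0` beyond
    show χ R * D R + (1 - χ R) * D 0 ≠ 0
    obtain ⟨h1, h2⟩ := hχ01 R
    rcases lt_or_ge |R| ρ₀ with hR | hR
    · have hDR := hneg R hR
      have : χ R * D R + (1 - χ R) * D 0 < 0 := by nlinarith
      exact this.ne
    · rw [hχ0 R (by linarith)]
      simp only [zero_mul, zero_add, sub_zero, one_mul]
      exact h0.ne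
  · show χ R * D R + (1 - χ R) * D 0 = D R
    rw [hχ1 R hR]; ring

end Summit.AtomisticToContinuum.HydrodynamicLimit.Theorems.SonicCavityRenewal

end
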